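import Summits.SmoothPoincare4.SmoothPoincare4.Theorems.ConvexBisectionAcyclicBisectionExistsDualDataExtension
import Summits.SmoothPoincare4.SmoothPoincare4.Theorems.ConvexBisectionAcyclicBisectionExistsDualDataExtensionTop
import Summits.SmoothPoincare4.SmoothPoincare4.Theorems.ConvexBisectionAcyclicBisectionExistsDualDataShallow
import HarnessLib

/-!
# The dual multi-attachment data, V: the record `D₂ : MultiAttachmentData g (𝓡∂ 4) W₂`
(helper file 5 of the wave-5 brick T3b (iv) "the dual multi-attachment data `D₂` on the complement
piece `W₂`" for stub `stub_T3_dualPresentation` (T3), line `modp-braid-orbits`, crux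
`ConvexBisection.AcyclicBisectionExists`, item stmt-SmoothPoincare4-10508; lead c5, worker X1)

Sequel of `…DualDataExtension.lean` and `…DualDataExtensionTop.lean`.  On Y6's concrete complement piece
`W₂ = RegularSublevel hΦ` (`hΦ : IsRegularLevel (𝓡 4) (levelFn D f G a κ δ) 0`), for a finite family `g`
of attaching maps on `W` with disjoint ranges read in `M'` as the dual vectors of the glued handle charts
(HT), the maps

  `jA := E` lifted to `W₂` (the stretch, file III),  `jB j := Θ_{f j} ∘ 𝓕` lifted to `W₂` (file II)

are the data of a simultaneous attachment of handles along `g` with `W₂` as the result: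

* §1 membership of the values in `{Φ ≤ 0}`, the gluing relation `E a = Θᵢ (𝓕 b) ↔ glueRel`
  (`extension_eq_chart_iff`), the cover (`levelFn_nonpos_cases`);
* §2 **`exists_attachmentData_of_family`**: the record, with the export clauses (`jA` is `j_N` at
  shallow points `‖y_λ‖² ≤ 1/4` of all tube coordinates, the tube formula for `jA`, the chart formula for `jB`).

The dual family `g j = dualMap … (f j)` satisfies the hypotheses (`gluedHandleChart_dualVec`, file I;
`pairwise_disjoint_range_dualMap`, file III): **`exists_dualAttachmentData`**, registered as
`helper_exists_dualAttachmentData`.  Everything here is proved; no named facts, no definitions.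

## References
* J. Milnor, *Lectures on the h-cobordism theorem* (1965), §3 (dual handles). [MilnorHCobordism1965]
* A. A. Kosinski, *Differential Manifolds* (1993), VI §6 (`M ∪ H^λ`). [Kosinski1993]
* R. İ. Baykur, *Kähler decomposition of 4-manifolds*, AGT 6 (2006), proof of Thm. 5.1. [Baykur2006]
-/

noncomputable section

-- the prescribed namespace `Summit.<P>.<Sub>.…` duplicates `SmoothPoincare4` (P = Sub)
set_option linter.dupNamespace false

open scoped Manifold ContDiff Topology

namespace Summit.SmoothPoincare4.SmoothPoincare4.Theorems.AcyclicBisectionExists.ModpBraidOrbits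

open Set Function Metric Filter Topology
open Literature.Topology.FourManifolds Literature.Topology.FourManifolds.HandleAttachingMap

section Record

variable {B : Type} [TopologicalSpace B] [T2Space B] [ChartedSpace (EuclideanHalfSpace 4) B]
  {ι : Type} [Finite ι] {h : ι → HandleAttachingMap 3 2 B}
  {X : Type} [TopologicalSpace X] [ChartedSpace (EuclideanHalfSpace 4) X] [IsManifold (𝓡∂ 4) ∞ X]
  (D : MultiAttachmentData h (𝓡∂ 4) X) {ι' : Type} [Finite ι'] (f : ι' → ι) {bX : BoundaryData (𝓡∂ 4) X (𝓡 3)}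
  {W : Type} [TopologicalSpace W] [ChartedSpace (EuclideanHalfSpace 4) W]
  [IsManifold (𝓡∂ 4) ∞ W] {bW : BoundaryData (𝓡∂ 4) W (𝓡 3)} [Nonempty bX.carrier]
  (G : BoundaryGlueData bX bW) {a κ δ : ℝ} [CompactSpace X] [T2Space X] [T2Space W] [CompactSpace W]
  (g : ι' → HandleAttachingMap 3 2 W) (col : (BoundaryManifold.boundaryData 3 W).Collar)

/-! ### §1 Membership, the gluing relation, the cover -/

omit [Finite ι'] [CompactSpace X] [T2Space X] [CompactSpace W] in
/-- **THE GLUING RELATION**: `E a = Θᵢ (𝓕 b) ↔ (g i).glueRel a b` (`←` by the tube formula; `→`: a tube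
point `a = g j y` forces `i = j` (disjoint charts) and `α y = b` (injectivity of `Θ ∘ 𝓕`); a point off the
tubes is impossible, `chart_modelF_ne_jN`). [cite: Kosinski1993, VI §6] -/
theorem extension_eq_chart_iff [Finite ι'] (ha : 0 < a) (hf : Injective f) (hCM : ∀ j, CollarAdapted D (f j) G a)
    (hκ : 0 < κ) (hκ2 : κ ≤ 1 / 2) (hδ : 0 < δ) (hδ2 : δ ≤ 1 / 2) (haδ : a * δ ≤ 1 / 5)
    (hdisj : Pairwise fun i j => Disjoint (range (g i).toFun) (range (g j).toFun))
    (hT : ∀ (j : ι') (y : ↥(handleTube 3 2)), gluedHandleChart D (f j) G a (dualVec a κ δ y) = G.jN ((g j).toFun y))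
    {E : W → G.d₂.Glued}
    (hE1 : ∀ w, (∀ (j : ι') (y : ↥(handleTube 3 2)), (g j).toFun y ≠ w) → E w = G.jN w)
    (hE2 : ∀ (j : ι') (y : ↥(handleTube 3 2)),
      lamSq 2 (((y : closedBall (0 : EuclideanSpace ℝ (Fin 4)) 1) : EuclideanSpace ℝ (Fin 4))) ≠ 1 →
      E ((g j).toFun y) = gluedHandleChart D (f j) G a (modelF a κ δ
        (handleInversion 2 (((y : closedBall (0 : EuclideanSpace ℝ (Fin 4)) 1) : EuclideanSpace ℝ (Fin 4))))))
    (i : ι') (w : ↥(coresComplement g)) (b : ↥(beltPiece 3 2)) :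
    E w = gluedHandleChart D (f i) G a (modelF a κ δ ((b : closedBall (0 : EuclideanSpace ℝ (Fin 4)) 1) : EuclideanSpace ℝ (Fin 4))) ↔
      (g i).glueRel (w : W) (b : closedBall (0 : EuclideanSpace ℝ (Fin 4)) 1) := by
  constructor
  · intro heq
    by_cases hex : ∃ (j : ι') (y : ↥(handleTube 3 2)), (g j).toFun y = (w : W)
    · obtain ⟨j, y, hy⟩ := hex
      have hy1 : lamSq 2 (((y : closedBall (0 : EuclideanSpace ℝ (Fin 4)) 1) : EuclideanSpace ℝ (Fin 4))) ≠ 1 :=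
        (apply_mem_coresComplement_iff hdisj j y).1 (hy ▸ w.2)
      rw [← hy, hE2 j y hy1] at heq
      obtain ⟨hx1, hxs, h0, hl1⟩ := tube_inv_mem y hy1
      have hus : sOf (handleInversion 2 (((y : closedBall (0 : EuclideanSpace ℝ (Fin 4)) 1) : EuclideanSpace ℝ (Fin 4)))) < 1 := by
        rw [sOf_eq_lamSq, hxs]; linarith
      have hV := mem_compDom_of_norm_le_one ha hκ hκ2 hδ hδ2 haδ hx1 hus
      have hV' := mem_compDom_of_norm_le_one ha hκ hκ2 hδ hδ2 haδ (belt_coe_mem b).1 (belt_coe_mem b).2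
      have hjj : f j = f i := by
        by_contra hne
        exact gluedHandleChart_ne D G ha hne (hCM j) (hCM i) hV.2 hV'.2 heq
      have hjj' : j = i := hf hjj
      subst hjj'
      have hαb := injOn_comp_modelF D (f j) G ha (hCM j) hκ hκ2 hδ hδ2 hV hV' heq
      exact ⟨y, hy1, hαb.symm, hy.symm⟩
    · push Not at hex
      rw [hE1 w hex] at heq
      exact absurd heq.symm (chart_modelF_ne_jN D f G g ha hκ hκ2 hδ hδ2 haδ hT i (belt_coe_mem b).1 (belt_coe_mem b).2 hex)
  · rintro ⟨y, hy1, hb, hw⟩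
    rw [hw, hE2 i y hy1, hb]

omit [CompactSpace X] [T2Space X] [CompactSpace W] in
/-- **THE COVER**: every point of `{Φ ≤ 0}` is a value of the stretch off the circles or of a dual handle
chart (`j_N w`: `w` on a tube is `j_N (g j y) = Θ (dualVec y)` with `dualVec y` in the dome, hence in the
image of `𝓕`; `w` off the tubes is `E w`; `j_M` of a suffix handle point with `H ≤ 0` in the open ball lies
in `N`, in the image of `𝓕`; the remaining points are seam points `j_M (∂X) = j_N (∂W)`).
[cite: Milnor1963, Thm. 3.1] -/
theorem levelFn_nonpos_cases (ha : 0 < a) (hf : Injective f) (hCM : ∀ j, CollarAdapted D (f j) G a)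
    (hκ : 0 < κ) (hκ2 : κ ≤ 1 / 2) (hδ : 0 < δ) (hδ2 : δ ≤ 1 / 2)
    (hT : ∀ (j : ι') (y : ↥(handleTube 3 2)), gluedHandleChart D (f j) G a (dualVec a κ δ y) = G.jN ((g j).toFun y))
    {E : W → G.d₂.Glued}
    (hE1 : ∀ w, (∀ (j : ι') (y : ↥(handleTube 3 2)), (g j).toFun y ≠ w) → E w = G.jN w)
    {q : G.d₂.Glued} (hq : levelFn D f G a κ δ q ≤ 0) :
    (∃ w : W, w ∈ coresComplement g ∧ E w = q) ∨
      ∃ (j : ι') (b : ↥(beltPiece 3 2)),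
        gluedHandleChart D (f j) G a (modelF a κ δ ((b : closedBall (0 : EuclideanSpace ℝ (Fin 4)) 1) : EuclideanSpace ℝ (Fin 4))) = q := by
  -- points of the image `Dome ∪ N` of `𝓕` are chart values
  have himg : ∀ (j : ι') {x : EuclideanSpace ℝ (Fin 4)}, x ∈ dualDome a κ δ ∪ cocoreNbhd κ δ →
      ∃ b : ↥(beltPiece 3 2),
        gluedHandleChart D (f j) G a (modelF a κ δ ((b : closedBall (0 : EuclideanSpace ℝ (Fin 4)) 1) : EuclideanSpace ℝ (Fin 4))) =
          gluedHandleChart D (f j) G a x := by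
    intro j x hx
    rw [← image_modelF_eq ha hκ hκ2 hδ hδ2] at hx
    obtain ⟨z, ⟨hz1, hzs⟩, rfl⟩ := hx
    have hzl : lamSq 2 z ≠ 1 := by rw [← sOf_eq_lamSq]; exact hzs.ne
    exact ⟨⟨⟨z, mem_closedBall_zero_iff.2 hz1⟩, hzl⟩, rfl⟩
  -- the `j_N` case
  have hN : ∀ w : W, (∃ w' : W, w' ∈ coresComplement g ∧ E w' = G.jN w) ∨
      ∃ (j : ι') (b : ↥(beltPiece 3 2)),
        gluedHandleChart D (f j) G a (modelF a κ δ ((b : closedBall (0 : EuclideanSpace ℝ (Fin 4)) 1) : EuclideanSpace ℝ (Fin 4))) =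
          G.jN w := by
    intro w
    by_cases hex : ∃ (j : ι') (y : ↥(handleTube 3 2)), (g j).toFun y = w
    · obtain ⟨j, y, rfl⟩ := hex
      right
      obtain ⟨b, hb⟩ := himg j (Or.inl (dualVec_mem_dualDome ha hκ (hκ2.trans (by norm_num)) hδ hδ2 y))
      exact ⟨j, b, hb.trans (hT j y)⟩
    · push Not at hex
      exact Or.inl ⟨w, mem_coresComplement_of_forall_ne hex, hE1 w hex⟩
  -- seam points of `X` are `j_N` points
  have hseam : ∀ z : bX.carrier, G.jM (bX.incl z) = G.jN (bW.incl (G.φ z)) := fun z => by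
    rw [G.jM_incl, G.jN_incl, Diffeomorph.symm_apply_apply]
  have hcov : q ∈ range G.jM ∪ range G.jN := by rw [G.range_jM_union_range_jN]; exact mem_univ _
  rcases hcov with ⟨y₀, rfl⟩ | ⟨w, rfl⟩
  · by_cases hex : ∃ (j : ι') (b₀ : ↥(beltPiece 3 2)), D.jB (f j) b₀ = y₀
    · obtain ⟨j, b₀, rfl⟩ := hex
      set x := ((b₀ : closedBall (0 : EuclideanSpace ℝ (Fin 4)) 1) : EuclideanSpace ℝ (Fin 4)) with hxd
      have hn : ‖x‖ ≤ 1 := mem_closedBall_zero_iff.1 b₀.1.2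
      rcases hn.lt_or_eq with hlt | hn1
      · have hH : modelH κ δ x ≤ 0 :=
          ((levelFn_jM_jB_nonpos_iff D f G ha hf hCM hκ hκ2 hδ hδ2 j b₀).1 hq).resolve_right hlt.ne
        right
        obtain ⟨b, hb⟩ := himg j (Or.inr (mem_cocoreNbhd_of_modelH_nonpos hκ hκ2 hδ hδ2 hlt hH))
        refine ⟨j, b, ?_⟩
        rw [hb, gluedHandleChart_of_norm_lt_one D (f j) G a hlt, beltBallPt_coe b₀ hlt]
      · have hbd : D.jB (f j) b₀ ∈ (𝓡∂ 4).boundary X := by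
          rw [mem_boundary_iff_of_isSmoothEmbedding (D.hjB (f j)).1 (D.hjB (f j)).2, mem_boundary_opens_iff,
            boundary_closedBall]
          exact hn1
        rw [← bX.range_incl] at hbd
        obtain ⟨z, hz⟩ := hbd
        rw [← hz, hseam]
        exact hN _
    · push Not at hex
      have h0 : levelFn D f G a κ δ (G.jM y₀) = 0 :=
        le_antisymm hq (by rw [levelFn_jM_of_forall_ne D f G ha hCM hκ hκ2 hex]; exact collarHeightFn_nonneg' _ y₀)
      rw [levelFn_jM_of_forall_ne D f G ha hCM hκ hκ2 hex, collarHeightFn_eq_zero_iff'] at h0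
      obtain ⟨z, rfl⟩ := h0
      rw [hseam]
      exact hN _
  · exact hN w

/-! ### §2 The record -/

/-- **THE MULTI-ATTACHMENT DATA ALONG A FAMILY READ AS DUAL VECTORS.**  For a finite family `g` of
attaching maps on `W` with disjoint ranges satisfying (HT), the complement piece `W₂ = {Φ ≤ 0}` is `W`
with handles attached simultaneously along `g`: `jA` the lifted stretch `E`, `jB j` the lifted dual handle
charts `Θ_{f j} ∘ 𝓕`; with the export clauses. [cite: MilnorHCobordism1965, §3] -/
theorem exists_attachmentData_of_family (ha : 0 < a) (hf : Injective f) (hCM : ∀ j, CollarAdapted D (f j) G a)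
    (hκ : 0 < κ) (hκ2 : κ ≤ 1 / 2) (hκ1 : κ ≤ 1) (hδ : 0 < δ) (hδ2 : δ ≤ 1 / 2) (haδ : a * δ ≤ 1 / 5)
    (hcol : ∀ (w : (BoundaryManifold.boundaryData 3 W).carrier) (x : bW.carrier),
      (BoundaryManifold.boundaryData 3 W).incl w = bW.incl x →
      ∀ t : Set.Icc (0 : ℝ) 1, col.toFun (w, t) = G.CN.toFun x ((t : ℝ) / (2 - t)))
    (hdisj : Pairwise fun i j => Disjoint (range (g i).toFun) (range (g j).toFun))
    (hT : ∀ (j : ι') (y : ↥(handleTube 3 2)), gluedHandleChart D (f j) G a (dualVec a κ δ y) = G.jN ((g j).toFun y))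
    (hΦ : IsRegularLevel (𝓡 4) (levelFn D f G a κ δ) 0) :
    ∃ D₂ : MultiAttachmentData g (𝓡∂ 4) (RegularSublevel hΦ),
      (∀ w : ↥(coresComplement g), (∀ (j : ι') (y : ↥(handleTube 3 2)), (g j).toFun y = (w : W) →
          lamSq 2 (((y : closedBall (0 : EuclideanSpace ℝ (Fin 4)) 1) : EuclideanSpace ℝ (Fin 4))) ≤ 1 / 4) →
        RegularSublevel.incl hΦ (D₂.jA w) = G.jN w) ∧
      (∀ (j : ι') (y : ↥(handleTube 3 2)) (hy : (g j).toFun y ∈ coresComplement g),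
        RegularSublevel.incl hΦ (D₂.jA ⟨(g j).toFun y, hy⟩) = gluedHandleChart D (f j) G a (modelF a κ δ
          (handleInversion 2 (((y : closedBall (0 : EuclideanSpace ℝ (Fin 4)) 1) : EuclideanSpace ℝ (Fin 4)))))) ∧
      (∀ (j : ι') (b : ↥(beltPiece 3 2)), RegularSublevel.incl hΦ (D₂.jB j b) =
        gluedHandleChart D (f j) G a (modelF a κ δ ((b : closedBall (0 : EuclideanSpace ℝ (Fin 4)) 1) : EuclideanSpace ℝ (Fin 4)))) := by
  obtain ⟨E, hE1, hE2⟩ := exists_extension D f G g hdisj (a := a) (κ := κ) (δ := δ)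
  have hmemE := levelFn_extension_nonpos D f G g col ha hf hCM hκ hκ2 hκ1 hδ hδ2 haδ hcol hdisj hE1 hE2
  have hmemF := fun (j : ι') (b : ↥(beltPiece 3 2)) =>
    levelFn_handleMap_nonpos D G f ha hf hCM hκ hκ2 hκ1 hδ hδ2 haδ col hcol j b
  -- `E` off the circles: immersion, continuity, injectivity, embedding
  have himm : Manifold.IsImmersion (𝓡∂ 4) (𝓡 4) ∞ (fun w : ↥(coresComplement g) => E w) :=
    Manifold.isImmersion_of_isImmersionAt_of_finrank_eq rfl fun w =>
      ((isImmersionAt_extension D f G g ha hCM hκ hκ2 hδ hδ2 haδ hdisj hE1 hE2 hT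
        w.2).isImmersionAtOfComplement_complement.comp_subtypeVal (coresComplement g) (y := w)).isImmersionAt
  have hcont : Continuous fun w : ↥(coresComplement g) => E w :=
    continuous_iff_continuousAt.2 fun w => (himm.isImmersionAt w).continuousAt
  have hinj := injOn_extension D f G g ha hf hCM hκ hκ2 hδ hδ2 haδ hdisj hE1 hE2 hT
  have hemb := isEmbedding_extension D f G g ha hf hCM hκ hκ2 hδ hδ2 haδ hdisj hE1 hE2 hcont hinj
  -- the maps
  let jA : ↥(coresComplement g) → RegularSublevel hΦ := fun w => RegularSublevel.mk hΦ (E w) (hmemE w)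
  let jB : ι' → ↥(beltPiece 3 2) → RegularSublevel hΦ := fun j b => RegularSublevel.mk hΦ
    (gluedHandleChart D (f j) G a (modelF a κ δ ((b : closedBall (0 : EuclideanSpace ℝ (Fin 4)) 1) : EuclideanSpace ℝ (Fin 4))))
    (hmemF j b)
  have hjAi : ∀ w, RegularSublevel.incl hΦ (jA w) = E w := fun w => rfl
  have hjBi : ∀ j b, RegularSublevel.incl hΦ (jB j b) =
      gluedHandleChart D (f j) G a (modelF a κ δ ((b : closedBall (0 : EuclideanSpace ℝ (Fin 4)) 1) : EuclideanSpace ℝ (Fin 4))) :=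
    fun j b => rfl
  -- glue
  have hglue : ∀ (i : ι') (w : ↥(coresComplement g)) (b : ↥(beltPiece 3 2)), jA w = jB i b ↔
      (g i).glueRel (w : W) (b : closedBall (0 : EuclideanSpace ℝ (Fin 4)) 1) := fun i w b => by
    rw [← (RegularSublevel.injective_incl hΦ).eq_iff, hjAi, hjBi]
    exact extension_eq_chart_iff D f G g ha hf hCM hκ hκ2 hδ hδ2 haδ hdisj hT hE1 hE2 i w b
  -- cover
  have hcover : range jA ∪ (⋃ i, range (jB i)) = univ := by
    refine eq_univ_of_forall fun p => ?_
    rcases levelFn_nonpos_cases D f G g ha hf hCM hκ hκ2 hδ hδ2 hT hE1 (RegularSublevel.apply_incl_le hΦ p) with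
      ⟨w, hw, he⟩ | ⟨j, b, he⟩
    · exact Or.inl ⟨⟨w, hw⟩, RegularSublevel.injective_incl hΦ he⟩
    · exact Or.inr (mem_iUnion.2 ⟨j, b, RegularSublevel.injective_incl hΦ he⟩)
  -- disjoint handles
  have hdisjB : Pairwise fun i j => Disjoint (range (jB i)) (range (jB j)) := by
    intro i j hij
    rw [Set.disjoint_left]
    rintro _ ⟨b, rfl⟩ ⟨b', he⟩
    exact handleMap_ne D (f j) G ha (hf.ne hij.symm) (hCM j) (hCM i) hκ hκ2 hδ hδ2 haδ b' b
      (congrArg (RegularSublevel.incl hΦ) he)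
  have hjB : ∀ i, Manifold.IsSmoothEmbedding (𝓡∂ 4) (𝓡∂ 4) ∞ (jB i) ∧ IsOpen (range (jB i)) := fun i =>
    isSmoothEmbedding_handleLift D G f ha hf hCM hκ hκ2 hκ1 hδ hδ2 haδ col hcol hΦ i
  -- the complement of the range of `jA` is the union of the (compact) dual cocore discs
  have hcompl : (range jA)ᶜ = ⋃ i : ι', jB i '' {b : ↥(beltPiece 3 2) |
      lamSq 2 (((b : closedBall (0 : EuclideanSpace ℝ (Fin 4)) 1) : EuclideanSpace ℝ (Fin 4))) = 0} := by
    ext p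
    constructor
    · intro hp
      have hp' : p ∈ range jA ∪ ⋃ i, range (jB i) := by rw [hcover]; exact mem_univ _
      obtain ⟨i, b, rfl⟩ : ∃ (i : ι') (b : ↥(beltPiece 3 2)), jB i b = p := by
        rcases hp' with hp' | hp'
        · exact absurd hp' hp
        · obtain ⟨i, hi⟩ := mem_iUnion.1 hp'
          obtain ⟨b, hb⟩ := hi
          exact ⟨i, b, hb⟩
      refine mem_iUnion.2 ⟨i, b, ?_, rfl⟩
      by_contra h0
      have h0' : lamSq 2 (((b : closedBall (0 : EuclideanSpace ℝ (Fin 4)) 1) : EuclideanSpace ℝ (Fin 4))) ≠ 0 := h0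
      have hb1 := belt_coe_mem b
      have hl0 := lt_of_le_of_ne (lamSq_nonneg 2 _) (Ne.symm h0')
      have hl1 : lamSq 2 (((b : closedBall (0 : EuclideanSpace ℝ (Fin 4)) 1) : EuclideanSpace ℝ (Fin 4))) < 1 := by
        rw [← sOf_eq_lamSq]; exact hb1.2
      obtain ⟨hmem, hne0, hne1⟩ := handleInversion_mem h0' b.2
      set y : ↥(handleTube 3 2) := ⟨⟨_, hmem⟩, hne0⟩ with hy
      have hrel : (g i).glueRel ((g i).toFun y) (b : closedBall (0 : EuclideanSpace ℝ (Fin 4)) 1) :=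
        ⟨y, hne1, (handleInversion_handleInversion hl0 hl1).symm, rfl⟩
      have hyA : (g i).toFun y ∈ coresComplement g := (apply_mem_coresComplement_iff hdisj i y).2 hne1
      exact hp ⟨⟨_, hyA⟩, (hglue i ⟨_, hyA⟩ b).2 hrel⟩
    · intro hp hp'
      obtain ⟨i, hi⟩ := mem_iUnion.1 hp
      obtain ⟨b, hb0, rfl⟩ := hi
      obtain ⟨w, hw⟩ := hp'
      exact ((hglue i w b).1 hw).lamSq_ne_zero hb0
  have hjAo : IsOpen (range jA) := by
    rw [← compl_compl (range jA), hcompl, isOpen_compl_iff]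
    refine isClosed_iUnion_of_finite fun i => (IsCompact.image ?_ (hjB i).1.contMDiff.continuous).isClosed
    rw [isEmbedding_belt_coe.isCompact_iff]
    have heq : (fun b : ↥(beltPiece 3 2) => ((b : closedBall (0 : EuclideanSpace ℝ (Fin 4)) 1) : EuclideanSpace ℝ (Fin 4))) ''
        {b : ↥(beltPiece 3 2) | lamSq 2 (((b : closedBall (0 : EuclideanSpace ℝ (Fin 4)) 1) : EuclideanSpace ℝ (Fin 4))) = 0} =
        closedBall (0 : EuclideanSpace ℝ (Fin 4)) 1 ∩ {v | lamSq 2 v = 0} := by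
      ext v
      constructor
      · rintro ⟨b, hb, rfl⟩
        exact ⟨b.1.2, hb⟩
      · rintro ⟨hv, h0⟩
        have h0' : lamSq 2 v = 0 := h0
        refine ⟨⟨⟨v, hv⟩, ?_⟩, h0', rfl⟩
        rw [mem_beltPiece]
        show lamSq 2 v ≠ 1
        rw [h0']; norm_num
    rw [heq]
    exact (isCompact_closedBall _ _).inter_right (isClosed_eq (continuous_lamSq 2) continuous_const)
  -- `jA` is a smooth embedding
  haveI : Nonempty ↥(coresComplement g) := by
    obtain ⟨x⟩ := (inferInstance : Nonempty bX.carrier)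
    refine ⟨⟨G.CN.toFun (G.φ x) (1 / 2), (mem_coresComplement g).2 fun i hi => ?_⟩⟩
    have hint := G.CN.isInteriorPoint_apply (G.φ x) (by norm_num : (0 : ℝ) < 1 / 2)
    exact ((𝓡∂ 4).isInteriorPoint_iff_not_isBoundaryPoint _).1 hint ((g i).core_subset_boundary hi)
  have hjA : Manifold.IsSmoothEmbedding (𝓡∂ 4) (𝓡∂ 4) ∞ jA := isSmoothEmbedding_sublevel_lift hΦ himm hemb hmemE hjAo
  refine ⟨⟨hdisj, jA, jB, hjA, hjAo, hjB, hcover, hglue, hdisjB⟩, fun w hw => ?_, fun j y hy => ?_, fun j b => rfl⟩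
  · exact extension_eq_jN_of_shallow_le D f G g hκ hT hE1 hE2 hw
  · exact hE2 j y ((apply_mem_coresComplement_iff hdisj j y).1 hy)

/-- **THE DUAL MULTI-ATTACHMENT DATA** (brick T3b (iv)): the complement piece `W₂ = {Φ ≤ 0}` of the pushed
prefix sub-handlebody inside Milnor's gluing `M' = X ∪_Ψ W` is `W` with the DUAL suffix handles attached
simultaneously along the dual attaching maps `dualMap … (f j)` (Milnor 1965, §3; Baykur 2006, proof of
Thm. 5.1), with the stretch `E` as `W`-piece and the lifted charts `Θ_{f j} ∘ 𝓕` as handle embeddings.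
[cite: MilnorHCobordism1965, §3] -/
theorem exists_dualAttachmentData (ha : 0 < a) (hf : Injective f) (hCM : ∀ j, CollarAdapted D (f j) G a)
    (hκ : 0 < κ) (hκ2 : κ ≤ 1 / 2) (hκ1 : κ ≤ 1) (hδ : 0 < δ) (hδ2 : δ ≤ 1 / 2) (haδ : a * δ ≤ 1 / 5)
    (hcol : ∀ (w : (BoundaryManifold.boundaryData 3 W).carrier) (x : bW.carrier),
      (BoundaryManifold.boundaryData 3 W).incl w = bW.incl x →
      ∀ t : Set.Icc (0 : ℝ) 1, col.toFun (w, t) = G.CN.toFun x ((t : ℝ) / (2 - t)))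
    (hΦ : IsRegularLevel (𝓡 4) (levelFn D f G a κ δ) 0) :
    ∃ D₂ : MultiAttachmentData (fun j : ι' => dualMap D bX bW G.φ col κ δ hκ hκ1 hδ hδ2 (f j)) (𝓡∂ 4) (RegularSublevel hΦ),
      (∀ w : ↥(coresComplement (fun j : ι' => dualMap D bX bW G.φ col κ δ hκ hκ1 hδ hδ2 (f j))),
        (∀ (j : ι') (y : ↥(handleTube 3 2)), (dualMap D bX bW G.φ col κ δ hκ hκ1 hδ hδ2 (f j)).toFun y = (w : W) →
          lamSq 2 (((y : closedBall (0 : EuclideanSpace ℝ (Fin 4)) 1) : EuclideanSpace ℝ (Fin 4))) ≤ 1 / 4) →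
        RegularSublevel.incl hΦ (D₂.jA w) = G.jN w) ∧
      (∀ (j : ι') (y : ↥(handleTube 3 2))
        (hy : (dualMap D bX bW G.φ col κ δ hκ hκ1 hδ hδ2 (f j)).toFun y ∈
          coresComplement (fun j : ι' => dualMap D bX bW G.φ col κ δ hκ hκ1 hδ hδ2 (f j))),
        RegularSublevel.incl hΦ (D₂.jA ⟨(dualMap D bX bW G.φ col κ δ hκ hκ1 hδ hδ2 (f j)).toFun y, hy⟩) =
          gluedHandleChart D (f j) G a (modelF a κ δ
            (handleInversion 2 (((y : closedBall (0 : EuclideanSpace ℝ (Fin 4)) 1) : EuclideanSpace ℝ (Fin 4)))))) ∧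
      (∀ (j : ι') (b : ↥(beltPiece 3 2)), RegularSublevel.incl hΦ (D₂.jB j b) =
        gluedHandleChart D (f j) G a (modelF a κ δ ((b : closedBall (0 : EuclideanSpace ℝ (Fin 4)) 1) : EuclideanSpace ℝ (Fin 4)))) :=
  exists_attachmentData_of_family D f G (fun j : ι' => dualMap D bX bW G.φ col κ δ hκ hκ1 hδ hδ2 (f j)) col ha hf hCM hκ
    hκ2 hκ1 hδ hδ2 haδ hcol (pairwise_disjoint_range_dualMap D f bX bW G.φ col hf hκ hκ1 hδ hδ2)
    (fun j y => gluedHandleChart_dualVec D (f j) G ha hκ hκ1 hδ hδ2 col hcol y) hΦ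

end Record

/-- **Registered helper `helper_exists_dualAttachmentData` = brick T3b (iv) of the sub-goal
`node_dual_presentation` of `stub_T3_dualPresentation` (wave 5, lead c5): THE DUAL MULTI-ATTACHMENT DATA
`D₂ : MultiAttachmentData (dual maps of the suffix handles) (𝓡∂ 4) W₂` on the concrete complement piece
`W₂ = RegularSublevel hΦ` of Milnor's gluing in standard form** — with `E := D₂.jA` equal to `j_N` at every
point all of whose dual-tube coordinates are shallow (in particular off the dual tube ranges) and
`F_j := D₂.jB j` the glued handle chart of the model dual handle map (the tube formula for `D₂.jA` is the
extra clause of `exists_dualAttachmentData`).  Milnor (1965), §3; Baykur (2006), proof of Thm. 5.1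
("`W₂` is `W` with the dual 2-handles attached"). [cite: MilnorHCobordism1965, §3] -/
theorem helper_exists_dualAttachmentData : ∀ {B : Type} [TopologicalSpace B] [T2Space B] [ChartedSpace (EuclideanHalfSpace 4) B] {ι : Type} [Finite ι] {h : ι → Literature.Topology.FourManifolds.HandleAttachingMap 3 2 B} {X : Type} [TopologicalSpace X] [ChartedSpace (EuclideanHalfSpace 4) X] [IsManifold (𝓡∂ 4) ∞ X] (D : Literature.Topology.FourManifolds.HandleAttachingMap.MultiAttachmentData h (𝓡∂ 4) X) {ι' : Type} [Finite ι'] (f : ι' → ι) {bX : Literature.Topology.FourManifolds.BoundaryData (𝓡∂ 4) X (𝓡 3)} {W : Type} [TopologicalSpace W] [ChartedSpace (EuclideanHalfSpace 4) W] [IsManifold (𝓡∂ 4) ∞ W] {bW : Literature.Topology.FourManifolds.BoundaryData (𝓡∂ 4) W (𝓡 3)} [Nonempty bX.carrier] (G : Literature.Topology.FourManifolds.BoundaryGlueData bX bW) {a κ δ : ℝ} [CompactSpace X] [T2Space X] [T2Space W] [CompactSpace W] (col : (Literature.Topology.FourManifolds.BoundaryManifold.boundaryData 3 W).Collar) (ha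 : 0 < a) (hf : Function.Injective f) (hCM : ∀ j, Summit.SmoothPoincare4.SmoothPoincare4.Theorems.AcyclicBisectionExists.ModpBraidOrbits.CollarAdapted D (f j) G a) (hκ : 0 < κ) (hκ2 : κ ≤ 1 / 2) (hκ1 : κ ≤ 1) (hδ : 0 < δ) (hδ2 : δ ≤ 1 / 2), a * δ ≤ 1 / 5 → (∀ (w : (Literature.Topology.FourManifolds.BoundaryManifold.boundaryData 3 W).carrier) (x : bW.carrier), (Literature.Topology.FourManifolds.BoundaryManifold.boundaryData 3 W).incl w = bW.incl x → ∀ t : Set.Icc (0 : ℝ) 1, col.toFun (w, t) = G.CN.toFun x ((t : ℝ) / (2 - t))) → ∀ (hΦ : Literature.Topology.FourManifolds.IsRegularLevel (𝓡 4) (Summit.SmoothPoincare4.SmoothPoincare4.Theorems.AcyclicBisectionExists.ModpBraidOrbits.levelFn D f G a κ δ) 0), ∃ D₂ : Literature.Topology.FourManifolds.HandleAttachingMap.MultiAttachmentData (fun j : ι' => Summit.SmoothPoincare4.SmoothPoincare4.Theorems.AcyclicBisectionExists.ModpBraidOrbits.dualMap D bX bW G.φ col κ δ hκ hκ1 hδ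 hδ2 (f j)) (𝓡∂ 4) (Literature.Topology.FourManifolds.RegularSublevel hΦ), (∀ w : ↥(Literature.Topology.FourManifolds.HandleAttachingMap.coresComplement (fun j : ι' => Summit.SmoothPoincare4.SmoothPoincare4.Theorems.AcyclicBisectionExists.ModpBraidOrbits.dualMap D bX bW G.φ col κ δ hκ hκ1 hδ hδ2 (f j))), (∀ (j : ι') (y : ↥(Literature.Topology.FourManifolds.handleTube 3 2)), (Summit.SmoothPoincare4.SmoothPoincare4.Theorems.AcyclicBisectionExists.ModpBraidOrbits.dualMap D bX bW G.φ col κ δ hκ hκ1 hδ hδ2 (f j)).toFun y = (w : W) → Literature.Topology.FourManifolds.lamSq 2 ((y : Metric.closedBall (0 : EuclideanSpace ℝ (Fin 4)) 1) : EuclideanSpace ℝ (Fin 4)) < 1 / 4) → Literature.Topology.FourManifolds.RegularSublevel.incl hΦ (D₂.jA w) = G.jN w) ∧ (∀ (j : ι') (b : ↥(Literature.Topology.FourManifolds.beltPiece 3 2)), Literature.Topology.FourManifolds.RegularSublevel.incl hΦ (D₂.jB j b) = Summit.SmoothPoincare4.SmoothPoincare4.Theorems.AcyclicBisectionExists.ModpBraidOrbits.gluedHandleChart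 D (f j) G a (Summit.SmoothPoincare4.SmoothPoincare4.Theorems.AcyclicBisectionExists.ModpBraidOrbits.modelF a κ δ ((b : Metric.closedBall (0 : EuclideanSpace ℝ (Fin 4)) 1) : EuclideanSpace ℝ (Fin 4)))) :=
  by
  intro B _ _ _ ι _ h X _ _ _ D ι' _ f bX W _ _ _ bW _ G a κ δ _ _ _ _ col ha hf hCM hκ hκ2 hκ1 hδ hδ2 haδ hcol hΦ
  obtain ⟨D₂, h1, -, h2⟩ := exists_dualAttachmentData D f G col ha hf hCM hκ hκ2 hκ1 hδ hδ2 haδ hcol hΦ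
  exact ⟨D₂, fun w hw => h1 w fun j y he => (hw j y he).le, h2⟩

end Summit.SmoothPoincare4.SmoothPoincare4.Theorems.AcyclicBisectionExists.ModpBraidOrbits

end
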